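import Mathlib
import HarnessLib
import Summits.QuantumFields.YangMills.Theses.GuardedThresholdRemoval

/-!
# Route `GuardedThresholdRemoval`, LINE g7-B: the glue of the split `GuardSphereThin ⇐ UnitLawCollarDominated → GuardCollarHaarSmall`, PROVED

`UnitLawCollarDominated → GuardCollarHaarSmall → GuardSphereThin`: given `ε`, dominate the unit laws by `C·dU` on the `η₀`-collar of the
guard spheres (uniformly in `K ≥ K₀`), choose `η₁` with `dU(collar_{η₁}) ≤ ε / max C 1`, and take `η := min η₀ η₁`. Pure measure
monotonicity; rung R3 bookkeeping, no summit is proved. [cite: Balaban1985UV3, (1)-(3) p.256]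
-/

namespace Summit.QuantumFields.YangMills.Theses.GuardedThresholdRemoval

open MeasureTheory
open Literature.MathematicalPhysics.QuantumFieldTheory.Balaban1983to89
open Literature.MathematicalPhysics.QuantumFieldTheory.Balaban1983to89.T3ContinuumYM3Torus
open Literature.MathematicalPhysics.QuantumFieldTheory.Balaban1983to89.T3UnitLawDensityEML (ℰp measurableE_ℰp)

/-- The split glue of LINE g7-B, proved: local Haar-domination at the guard plus Haar-smallness of the collars give guard-sphere thinness. [cite: Balaban1985UV3, (1)-(3) p.256] -/
theorem guardSphereThin_of_collar (h₁ : UnitLawCollarDominated) (h₂ : GuardCollarHaarSmall) : GuardSphereThin := by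
  obtain ⟨γ₂, hγ₂, hdom⟩ := h₁
  refine ⟨γ₂, hγ₂, fun F γ hγ hγle ε hε => ?_⟩
  obtain ⟨η₀, hη₀, C, K₀, hC⟩ := hdom F γ hγ hγle
  obtain ⟨η₁, hη₁, hsmall⟩ := h₂ F (ε / max C 1) (div_pos hε (lt_max_of_lt_right one_pos))
  refine ⟨min η₀ η₁, lt_min hη₀ hη₁, K₀, fun K hK => ?_⟩
  set μH := fieldMeasure (F.P 0) 0 (Matrix.specialUnitaryGroup (Fin 2) ℂ) with hμH
  set Sη : Set (GaugeField (F.P 0) 0 (Matrix.specialUnitaryGroup (Fin 2) ℂ)) :=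
    {u | ∃ (c : PBond (F.P 0) 1) (i : BlockAveraging.Idx (F.P 0)),
      |dist1 (BlockAveraging.loopHol u c i) - (ℰp).δ| < min η₀ η₁} with hSη
  have hsub0 : Sη ⊆ {u | ∃ (c : PBond (F.P 0) 1) (i : BlockAveraging.Idx (F.P 0)),
      |dist1 (BlockAveraging.loopHol u c i) - (ℰp).δ| < η₀} := by
    rintro u ⟨c, i, hu⟩; exact ⟨c, i, hu.trans_le (min_le_left _ _)⟩
  have hsub1 : Sη ⊆ {u | ∃ (c : PBond (F.P 0) 1) (i : BlockAveraging.Idx (F.P 0)),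
      |dist1 (BlockAveraging.loopHol u c i) - (ℰp).δ| < η₁} := by
    rintro u ⟨c, i, hu⟩; exact ⟨c, i, hu.trans_le (min_le_right _ _)⟩
  have hmax : 0 < max C 1 := lt_max_of_lt_right one_pos
  have hH : μH.real Sη ≤ ε / max C 1 := (measureReal_mono hsub1).trans hsmall
  calc (F.unitLaw ℰp measurableE_ℰp γ K).real Sη ≤ C * μH.real Sη := hC K hK Sη hsub0
    _ ≤ max C 1 * μH.real Sη := by gcongr; exact le_max_left _ _
    _ ≤ max C 1 * (ε / max C 1) := by gcongr
    _ = ε := mul_div_cancel₀ _ hmax.ne'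

/-- The glue item `GuardSphereThinGlue` (stmt-QuantumFields-28047) of the split, by name. [cite: Balaban1985UV3, (1)-(3) p.256] -/
theorem guardSphereThinGlue_holds : GuardSphereThinGlue := fun h₁ h₂ => guardSphereThin_of_collar h₁ h₂

end Summit.QuantumFields.YangMills.Theses.GuardedThresholdRemoval
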